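import Mathlib
import HarnessLib
import Literature.Analysis.FluidPDE.Tao2016AveragedNS.TaylorChainCertificate
import Summits.NavierStokesRegularity.NavierStokesRegularity.Theorems.TaylorModelRungThreeGDefs
import Summits.NavierStokesRegularity.NavierStokesRegularity.Theorems.TaylorModelRungThreeReadoutWindowBridge
import Summits.NavierStokesRegularity.NavierStokesRegularity.Theorems.TaylorModelRungThreeReadoutChainRestart

/-!
# Line `taylor-model` on crux K1b-DR (stmt-NavierStokesRegularity-23954) — STUB G1 `stub_chain : ChainEnclosureHolds`

The registered stub G1 of skeleton v4.2 (interface of record `Theorems/TaylorModelRungThreeGDefs.lean`,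
namespace `…Theorems.TaylorModel`): for every certificate `cd` with `cd.Valid` and every window flow `φ`
(`IsWindowFlow cd φ`), the CHAIN ENCLOSURE `ChainEnclosure cd φ` holds — (C1) the selector solves on each stage
horizon, (C2) node invariant at level `E` (`EI` for the base trajectory), (C3) in-step enclosures `Sp`/`SpI`,
(C4) κ-restarts at level `EO` with in-step `SpO`. Assembly of the helper files: the v4.1 → package bridge
(`isFlowPackage_of_isWindowFlow`), C1–C3 (`chain_C123`, helper 4) and C4 (`restart_C4`, helper 5), themselves built
on the Lohner node step (helpers 2–3), the majorant monotonicity (helper 1b), the weighted-ball / `Vap` algebra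
(helper 1a) and the abstract validated-step chain `Literature.Analysis.ODE.exists_solution_of_stepChain`.

MODEL-lattice bookkeeping only (rung TL-M3 of the NS ladder); nothing here is a statement about the Navier–Stokes
equations, and K1b-DR itself is not proved here (stubs S1, CERT, G3, G4 remain with their seats).
-/

noncomputable section

-- the sub-problem namespace repeats the summit name by design (D-0017)
set_option linter.dupNamespace false

namespace Summit.NavierStokesRegularity.NavierStokesRegularity.Theorems.TaylorModel

open Summit.NavierStokesRegularity.NavierStokesRegularity.Theorems.TaylorModelReadout

/-- **Stub G1 (`ChainEnclosureHolds`) of line `taylor-model` on crux K1b-DR: the Lohner-chain soundness of a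
valid Taylor-model chain certificate for every window flow.** [cite: Zgliczynski2002C1Lohner, §3–4] -/
theorem stub_chain : Summit.NavierStokesRegularity.NavierStokesRegularity.Theorems.TaylorModel.ChainEnclosureHolds := by
  intro cd φ hV hW j hj q hq
  have hF : IsFlowPackage cd φ := isFlowPackage_of_isWindowFlow hV hW
  obtain ⟨h1, h2, h3⟩ := chain_C123 hF hV hj hq
  exact ⟨h1, h2, h3, restart_C4 hF hV hj hq⟩

end Summit.NavierStokesRegularity.NavierStokesRegularity.Theorems.TaylorModel

end
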